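import Mathlib.MeasureTheory.Measure.Prokhorov
import Mathlib.MeasureTheory.Measure.LevyProkhorovMetric
import Literature.MathematicalPhysics.QuantumLattice.LiebWuThermodynamicLimit
import HarnessLib

/-!
# The thermodynamic limit of the Lieb–Wu roots: compactness and reduction of F3a to the
# identification of subsequential limits (Goldbaum 2005, §5)

Family `hubbard` (trunk T-QLATTICE), statement hubbard.S10 (`lieb_wu`). After
`LiebWuBetheAnsatz` (F1–F5b) and `LiebWuThermodynamicLimit` (F3 = F3a + F3c, F3c proved), the
node F3 (`liebWu_betheEnergy_tendsto`) rests on the single named fact F3a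
(`goldbaum_rootDensity_tendsto`): for `U > 0` and any family of ground-state roots of the Lieb–Wu
equations on the rings of `N_a = 4m + 2` sites at half filling, the empirical distribution
`(1/N_a) Σ_j δ_{k_j}` of the momenta converges weakly to Lieb–Wu's `ρ₀(k) dk`.

Goldbaum's printed proof of F3a (CMP 258 (2005) 317, §5) has three movements:

1. *compactness* — the step densities `ρ_i`, `σ_i` of the `k`'s and `Λ`'s are uniformly bounded
   ((5.1)–(5.4)), so "we can use Banach–Alaoglu theorem to show that there is a subsequence
   converging weakly";
2. *identification* — along such a subsequence the limits satisfy the Lieb–Wu integral equations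
   (5.10)–(5.11) on sets `Q`, `B`; at half filling "Lieb and Wu proved that `Q = [-π, π]` and
   `B = ℝ`" (Physica A 321 (2003) 1, §5, Theorems 2–3), the solution is unique (ibid. Theorem 1)
   and explicit ((5.16)–(5.17) = Lieb–Wu §6, boxed `ρ₀`, `σ₀`);
3. *conclusion* — "Since the solution is unique, and every subsequence of `{ρ_i}`, `{σ_i}`
   contains a further subsequence that converges to the same `ρ` and `σ`, we can actually prove
   that the whole sequence converges."

This file PROVES movements 1 and 3 and isolates movement 2 ("F3a′": along every subsequence on
which the empirical distributions of the `k`'s and of the `Λ`'s both converge weakly, the `k`-limit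
is `ρ₀ dk`) as the explicit HYPOTHESIS of the reduction theorems — per family
(`tendsto_sum_div_of_subseqLimit`, `betheEnergy_div_tendsto_of_subseqLimit`) and globally:

  `(∀ families, F3a′) → goldbaum_rootDensity_tendsto → liebWu_betheEnergy_tendsto`

(`goldbaum_rootDensity_tendsto_of_subseqLimit`, `liebWu_betheEnergy_tendsto_of_subseqLimit`).
F3a′ is deliberately NOT minted as a further named fact (D-0026): the debt stays on the existing
fact F3a, and discharging F3a (hence F3) is reduced to proving movement 2.

## What is proved here

* `empiricalProbabilityMeasure x = (n+1)⁻¹ Σ_j δ_{x_j}` for `x : Fin (n + 1) → ℝ`, as a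
  `MeasureTheory.ProbabilityMeasure ℝ` (so that "converges weakly" is convergence in Mathlib's
  topology of convergence in distribution), with `∫ g = (Σ_j g(x_j))/(n+1)` and the counting formula
  for the mass of a set.
* Movement 1 for the momenta: the `k_j` lie in `[-π, π]`, so their empirical measures form a tight
  set and have compact closure (Prokhorov, `isCompact_closure_of_isTightMeasureSet`).
* Movement 1 for the `Λ`'s (Goldbaum (5.4): "`{σ_i}` is uniformly bounded"; here in the form that
  is needed for weak — not only vague — convergence, i.e. TIGHTNESS, which the printed text does
  not spell out): from the second Lieb–Wu equation, for `1 ≤ R`,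
  `#{α : Λ_α > R} ≤ 1 + N_a (π - 2 arctan(4(R-1)/U)) / (2π)` and symmetrically for `Λ_α < -R`
  (`card_filter_lt_rapidity_le`, `card_filter_rapidity_lt_neg_le`): subtracting the equations for
  two indices `α ≤ α'` gives `2π(J_{α'} - J_α) = Σ_j [θ(2 sin k_j - 2Λ_{α'}) - θ(2 sin k_j - 2Λ_α)]
  + Σ_β [θ(Λ_{α'} - Λ_β) - θ(Λ_α - Λ_β)]`, the second sum is `≤ 0` (`θ` is decreasing) and each
  term of the first is `< π - 2 arctan(4(R-1)/U)` once `Λ_α > R ≥ 1` (`|θ| < π`,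
  `|sin k_j| ≤ 1`). Hence the empirical measures of the `Λ`'s are tight
  (`isTightMeasureSet_rapidityMeasures`) and have compact closure.
* Movement 3: `ProbabilityMeasure ℝ` is metrizable (Lévy–Prokhorov), so compact sets are
  sequentially compact; `Filter.tendsto_of_subseq_tendsto` then upgrades F3a′ to F3a. Continuous
  test functions are made bounded by clamping to `[-π, π]`, which does not change their values at
  the roots nor the limit integral.

## Rigour notes on movement 2 (for the eventual discharge of F3a; not used in this file)

Writing `z_i(k) = k/2π + (1/2π N_a) Σ_β 2 arctan(4(sin k - Λ_β)/U)` and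
`w_i(Λ) = (1/2π N_a)[Σ_j 2 arctan(4(Λ - sin k_j)/U) - Σ_β 2 arctan(2(Λ - Λ_β)/U)]`, the Lieb–Wu
equations with the ground-state quantum numbers say exactly `z_i(k_j) = I_j/N_a`,
`w_i(Λ_α) = J_α/N_a` (one root per level, consecutive levels), and `z_i' = 1/2π + cos k (K∗S_i)(sin k)`,
`w_i' = ∫K(Λ - sin k) dμ_i - K²∗S_i` are the finite-`N_a` forms of Lieb–Wu's (ρ), (σ). A
subsequential limit `(ρ, σ)` satisfies `ρ = z'·q₁`, `σ = w'·q₂` with `0 ≤ q ≤ 1` (Goldbaum takes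
`q` = indicators of `Q`, `B`), and the identification `q ≡ 1` at half filling ("`Q = [-π, π]`,
`B = ℝ`") amounts to `z' ≥ 0`, `w' ≥ 0` for every limit point, i.e. to Lieb–Wu's Lemma 3
(`f < 2t`) for the limit system; Lieb–Wu prove it for interval supports. This is the analytic
crux of F3a and is why movement 2 is a hypothesis here rather than a theorem.

## Design notes

* The hypothesis F3a′ asks for the `Λ`-measures to converge too (as in Goldbaum's text: a
  subsequence on which both families converge), which makes it WEAKER than the `k`-only version;
  the tightness proved here is what makes the weaker hypothesis sufficient. The `Λ`-measures are
  normalised by `M = 2m + 1` (probability measures); Goldbaum's `σ_i` is `(M/N_a) = 1/2` times ours.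
* Only the `k`-part of the limit ((5.16), `ρ₀`) is asked for, as in F3a; (5.17) (`σ₀`) is not
  needed for `lieb_wu`.
* `tendsto_integral_rootMeasure_of_subseqLimit` is the abstract subsequence principle (limit value
  `c` arbitrary), so that partial identifications (e.g. of single moments) can reuse movements 1, 3.
* Mathlib: `MeasureTheory.ProbabilityMeasure`, `isCompact_closure_of_isTightMeasureSet`,
  `isTightMeasureSet_iff_exists_isCompact_measure_compl_le`,
  `ProbabilityMeasure.tendsto_iff_forall_integral_tendsto`, `instMetrizableSpaceProbabilityMeasure`,
  `IsCompact.tendsto_subseq`, `Filter.tendsto_of_subseq_tendsto`,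
  `BoundedContinuousFunction.ofNormedAddCommGroup`. Nothing about Bethe roots is in Mathlib.

## Sources

* P. S. Goldbaum, *Existence of solutions to the Bethe ansatz equations for the 1D Hubbard model:
  finite lattice and thermodynamic limit*, CMP 258 (2005) 317–337 = arXiv:cond-mat/0403736
  (held; key `Goldbaum2005`): §5, (5.1)–(5.4) (bounds), (5.5)–(5.15) (limit equations),
  (5.16)–(5.17) (the limit), and the closing paragraph of §5 (whole-sequence convergence).
* E. H. Lieb, F. Y. Wu, *The one-dimensional Hubbard model: a reminiscence*, Physica A 321 (2003)
  1–27 = arXiv:cond-mat/0207529 (held; key `LiebWuPhysicaA2003`): §3 (Lieb–Wu equations, `θ`),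
  §5 Theorems 1–3 and Lemma 3, §6 (boxed `ρ₀`, `σ₀`).
-/

noncomputable section

namespace Literature.MathematicalPhysics.QuantumLattice

open Filter Finset MeasureTheory Set Real
open Literature.Analysis.FunctionSpaces
open scoped _root_.Topology BigOperators ENNReal NNReal BoundedContinuousFunction

/-! ### Empirical probability measures of finitely many reals -/

/-- The **empirical probability measure** `(n+1)⁻¹ Σ_j δ_{x_j}` of `n + 1` real numbers
`x₀, …, x_n`, as a Borel probability measure on `ℝ` (Goldbaum's "sequence of distributions
measuring the density of `k`-s and `Λ`-s", CMP 258 (2005) 317, §1 and §5, here for the atoms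
themselves rather than for the step densities (5.1)). [folklore] -/
def empiricalProbabilityMeasure {n : ℕ} (x : Fin (n + 1) → ℝ) : ProbabilityMeasure ℝ :=
  ⟨((n + 1 : ℕ) : ℝ≥0∞)⁻¹ • ∑ j, Measure.dirac (x j), by
    refine ⟨?_⟩
    simp only [Measure.smul_apply, Measure.coe_finsetSum, Finset.sum_apply, measure_univ,
      Finset.sum_const, Finset.card_univ, Fintype.card_fin, nsmul_eq_mul, mul_one, smul_eq_mul]
    exact ENNReal.inv_mul_cancel (by exact_mod_cast Nat.succ_ne_zero n) (ENNReal.natCast_ne_top _)⟩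

/-- Unfolding of the empirical probability measure to `(n+1)⁻¹ Σ_j δ_{x_j}`. [folklore] -/
theorem coe_empiricalProbabilityMeasure {n : ℕ} (x : Fin (n + 1) → ℝ) :
    (empiricalProbabilityMeasure x : Measure ℝ) = ((n + 1 : ℕ) : ℝ≥0∞)⁻¹ • ∑ j, Measure.dirac (x j) :=
  rfl

/-- Integration against the empirical measure is averaging over the atoms:
`∫ g d((n+1)⁻¹ Σ_j δ_{x_j}) = (Σ_j g(x_j)) / (n + 1)`. [folklore] -/
theorem integral_empiricalProbabilityMeasure {n : ℕ} (x : Fin (n + 1) → ℝ) (g : ℝ → ℝ) :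
    ∫ t, g t ∂(empiricalProbabilityMeasure x : Measure ℝ) = (∑ j, g (x j)) / ((n : ℝ) + 1) := by
  rw [coe_empiricalProbabilityMeasure, integral_smul_measure,
    integral_finsetSum_measure fun j _ => integrable_dirac (by simp)]
  simp only [integral_dirac, smul_eq_mul, ENNReal.toReal_inv, ENNReal.toReal_natCast]
  push_cast
  ring

/-- The mass the empirical measure gives to a set is the fraction of atoms in it:
`((n+1)⁻¹ Σ_j δ_{x_j})(s) = #{j : x_j ∈ s} / (n + 1)`. [folklore] -/
theorem empiricalProbabilityMeasure_apply {n : ℕ} (x : Fin (n + 1) → ℝ) (s : Set ℝ)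
    [DecidablePred (· ∈ s)] :
    (empiricalProbabilityMeasure x : Measure ℝ) s =
      ((univ.filter fun j => x j ∈ s).card : ℝ≥0∞) * (((n + 1 : ℕ) : ℝ≥0∞))⁻¹ := by
  rw [coe_empiricalProbabilityMeasure, Measure.smul_apply, Measure.coe_finsetSum, Finset.sum_apply]
  have h : ∀ j, Measure.dirac (x j) s = if x j ∈ s then 1 else 0 := fun j => by
    rw [Measure.dirac_apply]
    by_cases hj : x j ∈ s <;> simp [hj]
  simp only [h, Finset.sum_boole, smul_eq_mul]
  ring

/-- If no atom lies in `s`, the empirical measure of `s` vanishes. [folklore] -/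
theorem empiricalProbabilityMeasure_apply_eq_zero {n : ℕ} (x : Fin (n + 1) → ℝ) {s : Set ℝ}
    (hs : ∀ j, x j ∉ s) : (empiricalProbabilityMeasure x : Measure ℝ) s = 0 := by
  classical
  rw [empiricalProbabilityMeasure_apply]
  have : (univ.filter fun j => x j ∈ s) = ∅ :=
    Finset.filter_eq_empty_iff.2 fun j _ => hs j
  simp [this]

/-- The mass of a set under the empirical measure, as a real number, is at most
`#{j : x_j ∈ s} / (n + 1)` (in fact equal). [folklore] -/
theorem empiricalProbabilityMeasure_apply_le_ofReal {n : ℕ} (x : Fin (n + 1) → ℝ) (s : Set ℝ)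
    [DecidablePred (· ∈ s)] :
    (empiricalProbabilityMeasure x : Measure ℝ) s ≤
      ENNReal.ofReal (((univ.filter fun j => x j ∈ s).card : ℝ) / ((n : ℝ) + 1)) := by
  rw [empiricalProbabilityMeasure_apply]
  have hn : (0 : ℝ) < (n : ℝ) + 1 := by positivity
  rw [ENNReal.ofReal_div_of_pos hn, div_eq_mul_inv]
  gcongr
  · exact (ENNReal.ofReal_natCast _).symm.le
  · rw [ENNReal.ofReal_add (by positivity) zero_le_one, ENNReal.ofReal_natCast, ENNReal.ofReal_one]
    push_cast
    exact le_rfl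

/-! ### Movement 2 (Goldbaum 2005, §5, (5.5)–(5.16)): the hypothesis "F3a′" of the reductions

The identification step of the printed proof is, for one family of ground-state roots `(k, Λ)`:

  *along every subsequence `φ` on which the empirical distributions of the momenta `k_j` AND of
  the `Λ_α` both converge weakly (to Borel probability measures `ν`, `τ` on `ℝ`), the `k`-limit is
  Lieb–Wu's `ρ₀(k) dk` on `[-π, π]`: `∫ g dν = ∫_{-π}^{π} g ρ₀` for every bounded continuous `g`*

(printed argument: the limits have bounded densities `ρ`, `σ` ((5.1)–(5.4)); passing to the limit
in the differenced Lieb–Wu equations (5.5)–(5.9) they satisfy the integral equations (5.10)–(5.11)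
on the sets `Q`, `B` where the roots accumulate; at half filling `Q = [-π, π]`, `B = ℝ` (Lieb–Wu
2003, §5, Theorems 2–3), and the solution of (5.14)–(5.15) is unique (ibid. Theorem 1) and equal
to `ρ₀`, `σ₀` ((5.16)–(5.17) = Lieb–Wu 2003, §6)). It is NOT vendored as a named fact in this file
(D-0026: the fact it refines, F3a `goldbaum_rootDensity_tendsto`, already carries the debt); it
appears verbatim as the hypothesis `h` of the reduction theorems of movement 3 below, per family
(`tendsto_sum_div_of_subseqLimit`, `betheEnergy_div_tendsto_of_subseqLimit`) and globally
(`goldbaum_rootDensity_tendsto_of_subseqLimit : (∀ families, F3a′) → F3a`,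
`liebWu_betheEnergy_tendsto_of_subseqLimit : (∀ families, F3a′) → F3`). -/

/-! ### Movement 1 for the momenta: support in `[-π, π]` -/

/-- The empirical measures of the ground-state momenta give no mass to the complement of
`[-π, π]` (Goldbaum's Theorem 1.1: `-π ≤ k_1 < ⋯ < k_N ≤ π`). [cite: Goldbaum2005, Theorem 1.1] -/
theorem rootMeasure_compl_Icc_eq_zero {U : ℝ} {m : ℕ} {k : Fin (4 * m + 2) → ℝ}
    {Λ : Fin (2 * m + 1) → ℝ} (hk : IsLiebWuGroundRoots U m k Λ) :
    (empiricalProbabilityMeasure k : Measure ℝ) (Icc (-π) π)ᶜ = 0 :=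
  empiricalProbabilityMeasure_apply_eq_zero k fun j h => h (hk.2.2.2 j)

/-- The empirical measures of the momenta of any family of ground-state roots form a tight set
(they live on the compact interval `[-π, π]`). [cite: Goldbaum2005, §5, (5.1)–(5.2)] -/
theorem isTightMeasureSet_rootMeasures {U : ℝ} {k : ∀ m : ℕ, Fin (4 * m + 2) → ℝ}
    {Λ : ∀ m : ℕ, Fin (2 * m + 1) → ℝ} (hk : ∀ m, IsLiebWuGroundRoots U m (k m) (Λ m)) :
    IsTightMeasureSet
      {((μ : ProbabilityMeasure ℝ) : Measure ℝ) |
        μ ∈ Set.range fun m => empiricalProbabilityMeasure (k m)} := by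
  rw [isTightMeasureSet_iff_exists_isCompact_measure_compl_le]
  intro ε _
  refine ⟨Icc (-π) π, isCompact_Icc, ?_⟩
  rintro μ ⟨μ', ⟨m, rfl⟩, rfl⟩
  rw [rootMeasure_compl_Icc_eq_zero (hk m)]
  exact bot_le

/-- **Compactness for the momenta (Goldbaum 2005, §5, "Banach–Alaoglu").** The closure of the set
of empirical measures of the momenta of a family of ground-state roots is compact in the topology
of weak convergence (Prokhorov). [cite: Goldbaum2005, §5, (5.1)–(5.2)] -/
theorem isCompact_closure_rootMeasures {U : ℝ} {k : ∀ m : ℕ, Fin (4 * m + 2) → ℝ}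
    {Λ : ∀ m : ℕ, Fin (2 * m + 1) → ℝ} (hk : ∀ m, IsLiebWuGroundRoots U m (k m) (Λ m)) :
    IsCompact (closure (Set.range fun m => empiricalProbabilityMeasure (k m))) :=
  isCompact_closure_of_isTightMeasureSet (isTightMeasureSet_rootMeasures hk)

/-! ### Movement 1 for the `Λ`'s: tightness from the second Lieb–Wu equation -/

/-- `θ = liebWuTheta U` is decreasing for `U > 0` (`θ(p) = -2 arctan(2p/U)`).
[cite: LiebWuPhysicaA2003, §3] -/
theorem liebWuTheta_antitone {U : ℝ} (hU : 0 < U) : Antitone (liebWuTheta U) := by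
  intro p q hpq
  simp only [liebWuTheta]
  have : Real.arctan (2 * p / U) ≤ Real.arctan (2 * q / U) :=
    Real.arctan_mono (by gcongr)
  linarith

/-- Differencing the second Lieb–Wu equation between two indices `α ≤ α'` of a family of
ground-state roots: `2π(α' - α) ≤ Σ_j [θ(2 sin k_j - 2Λ_{α'}) - θ(2 sin k_j - 2Λ_α)]`, because
`J_{α'} - J_α = α' - α` and the `Λ`–`Λ` terms contribute `Σ_β [θ(Λ_{α'} - Λ_β) - θ(Λ_α - Λ_β)] ≤ 0`
(`θ` decreasing, `Λ` increasing). Goldbaum, CMP 258 (2005) 317, §5 (the differenced equations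
behind (5.4)). [cite: Goldbaum2005, §5, eq. (5.4)] -/
theorem two_pi_mul_sub_le_sum_liebWuTheta_sub {U : ℝ} (hU : 0 < U) {m : ℕ}
    {k : Fin (4 * m + 2) → ℝ} {Λ : Fin (2 * m + 1) → ℝ} (hk : IsLiebWuGroundRoots U m k Λ)
    {α α' : Fin (2 * m + 1)} (hαα' : α ≤ α') :
    2 * π * ((α' : ℝ) - α) ≤
      ∑ j, (liebWuTheta U (2 * Real.sin (k j) - 2 * Λ α') -
        liebWuTheta U (2 * Real.sin (k j) - 2 * Λ α)) := by
  have hΛmono : Monotone Λ := hk.2.2.1.monotone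
  have eα := hk.1.2 α
  have eα' := hk.1.2 α'
  have hJ : liebWuGroundNumbers (2 * m + 1) α' - liebWuGroundNumbers (2 * m + 1) α = (α' : ℝ) - α := by
    simp only [liebWuGroundNumbers]
    ring
  -- the `Λ`–`Λ` sums: `Σ_β θ(Λ_{α'} - Λ_β) ≤ Σ_β θ(Λ_α - Λ_β)`
  have hΛΛ : ∑ β, liebWuTheta U (Λ α' - Λ β) ≤ ∑ β, liebWuTheta U (Λ α - Λ β) :=
    Finset.sum_le_sum fun β _ => liebWuTheta_antitone hU (by linarith [hΛmono hαα'])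
  rw [Finset.sum_sub_distrib, eα, eα']
  nlinarith [hΛΛ, hJ, Real.pi_pos]

/-- The tail estimate, right tail: each term of the differenced sum is at most
`π - 2 arctan(4(R-1)/U)` once `Λ_α > R ≥ 1`, since `θ < π` and
`θ(2 sin k_j - 2Λ_α) ≥ θ(2 - 2R) = 2 arctan(4(R-1)/U)`. [cite: Goldbaum2005, §5, eq. (5.4)] -/
theorem liebWuTheta_sub_le_of_lt_rapidity {U : ℝ} (hU : 0 < U) {R s Λ₁ Λ₂ : ℝ} (hs : s ≤ 1)
    (hR : R < Λ₁) :
    liebWuTheta U (2 * s - 2 * Λ₂) - liebWuTheta U (2 * s - 2 * Λ₁) ≤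
      π - 2 * Real.arctan (4 * (R - 1) / U) := by
  have h1 : liebWuTheta U (2 * s - 2 * Λ₂) < π := (abs_lt.1 (abs_liebWuTheta_lt U _)).2
  have h2 : 2 * Real.arctan (4 * (R - 1) / U) ≤ liebWuTheta U (2 * s - 2 * Λ₁) := by
    simp only [liebWuTheta]
    have : Real.arctan (2 * (2 * s - 2 * Λ₁) / U) ≤ Real.arctan (-(4 * (R - 1) / U)) := by
      refine Real.arctan_mono ?_
      rw [div_le_iff₀ hU]
      have e : -(4 * (R - 1) / U) * U = -(4 * (R - 1)) := by field_simp
      rw [e]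
      linarith
    rw [Real.arctan_neg] at this
    linarith
  linarith

/-- The tail estimate, left tail: each term of the differenced sum is at most
`π - 2 arctan(4(R-1)/U)` once `Λ_{α'} < -R ≤ -1`. [cite: Goldbaum2005, §5, eq. (5.4)] -/
theorem liebWuTheta_sub_le_of_rapidity_lt_neg {U : ℝ} (hU : 0 < U) {R s Λ₁ Λ₂ : ℝ}
    (hs : -1 ≤ s) (hR : Λ₂ < -R) :
    liebWuTheta U (2 * s - 2 * Λ₂) - liebWuTheta U (2 * s - 2 * Λ₁) ≤
      π - 2 * Real.arctan (4 * (R - 1) / U) := by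
  have h1 : -π < liebWuTheta U (2 * s - 2 * Λ₁) := (abs_lt.1 (abs_liebWuTheta_lt U _)).1
  have h2 : liebWuTheta U (2 * s - 2 * Λ₂) ≤ -(2 * Real.arctan (4 * (R - 1) / U)) := by
    simp only [liebWuTheta]
    have : Real.arctan (4 * (R - 1) / U) ≤ Real.arctan (2 * (2 * s - 2 * Λ₂) / U) := by
      refine Real.arctan_mono ?_
      rw [div_le_div_iff_of_pos_right hU]
      linarith
    linarith
  linarith

/-- **Right tail count (Goldbaum 2005, §5, the bound behind (5.4)).** For a family of
ground-state roots on the ring of `N_a = 4m + 2` sites, `U > 0` and any real `R` (the bound is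
informative for `R ≥ 1`), the number of `Λ_α` exceeding `R` is at most
`1 + N_a (π - 2 arctan(4(R-1)/U)) / (2π)`. [cite: Goldbaum2005, §5, eq. (5.4)] -/
theorem card_filter_lt_rapidity_le {U : ℝ} (hU : 0 < U) {m : ℕ} {k : Fin (4 * m + 2) → ℝ}
    {Λ : Fin (2 * m + 1) → ℝ} (hk : IsLiebWuGroundRoots U m k Λ) (R : ℝ) :
    ((univ.filter fun α => R < Λ α).card : ℝ) ≤
      1 + (4 * m + 2 : ℝ) * (π - 2 * Real.arctan (4 * (R - 1) / U)) / (2 * π) := by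
  set A := univ.filter fun α => R < Λ α with hA
  have hδ : 0 ≤ π - 2 * Real.arctan (4 * (R - 1) / U) := by
    linarith [Real.arctan_lt_pi_div_two (4 * (R - 1) / U)]
  rcases A.eq_empty_or_nonempty with hAe | hAne
  · rw [hAe, Finset.card_empty, Nat.cast_zero]
    positivity
  · set a := A.min' hAne
    set b := A.max' hAne
    have ha : a ∈ A := A.min'_mem hAne
    have hab : a ≤ b := A.min'_le _ (A.max'_mem hAne)
    have hRa : R < Λ a := (Finset.mem_filter.1 ha).2
    -- `A ⊆ [a, b]`, so `#A ≤ b - a + 1`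
    have hsub : A ⊆ Finset.Icc a b := fun α hα =>
      Finset.mem_Icc.2 ⟨A.min'_le α hα, A.le_max' α hα⟩
    have hcard : (A.card : ℝ) ≤ (b : ℝ) - a + 1 := by
      have h1 : A.card ≤ (b : ℕ) + 1 - a := (Finset.card_le_card hsub).trans (Fin.card_Icc a b).le
      have h2 : ((b : ℕ) + 1 - (a : ℕ) : ℕ) = ((b : ℝ) - a + 1 : ℝ) := by
        rw [Nat.cast_sub (by have := Fin.le_iff_val_le_val.1 hab; omega)]
        push_cast
        ring
      exact_mod_cast (Nat.cast_le (α := ℝ)).2 h1 |>.trans h2.le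
    -- the differenced equation between `a` and `b`
    have hdiff := two_pi_mul_sub_le_sum_liebWuTheta_sub hU hk hab
    have hterm : ∀ j ∈ (Finset.univ : Finset (Fin (4 * m + 2))),
        liebWuTheta U (2 * Real.sin (k j) - 2 * Λ b) -
          liebWuTheta U (2 * Real.sin (k j) - 2 * Λ a) ≤ π - 2 * Real.arctan (4 * (R - 1) / U) :=
      fun j _ => liebWuTheta_sub_le_of_lt_rapidity hU (Real.sin_le_one _) hRa
    have hsum := Finset.sum_le_sum hterm
    rw [Finset.sum_const, Finset.card_univ, Fintype.card_fin, nsmul_eq_mul] at hsum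
    push_cast at hsum
    have hπ : 0 < 2 * π := by positivity
    have key : (b : ℝ) - a ≤ (4 * m + 2 : ℝ) * (π - 2 * Real.arctan (4 * (R - 1) / U)) / (2 * π) := by
      rw [le_div_iff₀ hπ]
      linarith
    linarith

/-- **Left tail count.** Symmetrically, the number of `Λ_α` below `-R` is at most
`1 + N_a (π - 2 arctan(4(R-1)/U)) / (2π)`. [cite: Goldbaum2005, §5, eq. (5.4)] -/
theorem card_filter_rapidity_lt_neg_le {U : ℝ} (hU : 0 < U) {m : ℕ} {k : Fin (4 * m + 2) → ℝ}
    {Λ : Fin (2 * m + 1) → ℝ} (hk : IsLiebWuGroundRoots U m k Λ) (R : ℝ) :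
    ((univ.filter fun α => Λ α < -R).card : ℝ) ≤
      1 + (4 * m + 2 : ℝ) * (π - 2 * Real.arctan (4 * (R - 1) / U)) / (2 * π) := by
  set A := univ.filter fun α => Λ α < -R with hA
  have hδ : 0 ≤ π - 2 * Real.arctan (4 * (R - 1) / U) := by
    linarith [Real.arctan_lt_pi_div_two (4 * (R - 1) / U)]
  rcases A.eq_empty_or_nonempty with hAe | hAne
  · rw [hAe, Finset.card_empty, Nat.cast_zero]
    positivity
  · set a := A.min' hAne
    set b := A.max' hAne
    have hb : b ∈ A := A.max'_mem hAne
    have hab : a ≤ b := A.min'_le _ (A.max'_mem hAne)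
    have hRb : Λ b < -R := (Finset.mem_filter.1 hb).2
    have hsub : A ⊆ Finset.Icc a b := fun α hα =>
      Finset.mem_Icc.2 ⟨A.min'_le α hα, A.le_max' α hα⟩
    have hcard : (A.card : ℝ) ≤ (b : ℝ) - a + 1 := by
      have h1 : A.card ≤ (b : ℕ) + 1 - a := (Finset.card_le_card hsub).trans (Fin.card_Icc a b).le
      have h2 : ((b : ℕ) + 1 - (a : ℕ) : ℕ) = ((b : ℝ) - a + 1 : ℝ) := by
        rw [Nat.cast_sub (by have := Fin.le_iff_val_le_val.1 hab; omega)]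
        push_cast
        ring
      exact_mod_cast (Nat.cast_le (α := ℝ)).2 h1 |>.trans h2.le
    have hdiff := two_pi_mul_sub_le_sum_liebWuTheta_sub hU hk hab
    have hterm : ∀ j ∈ (Finset.univ : Finset (Fin (4 * m + 2))),
        liebWuTheta U (2 * Real.sin (k j) - 2 * Λ b) -
          liebWuTheta U (2 * Real.sin (k j) - 2 * Λ a) ≤ π - 2 * Real.arctan (4 * (R - 1) / U) :=
      fun j _ => liebWuTheta_sub_le_of_rapidity_lt_neg hU (Real.neg_one_le_sin _) hRb
    have hsum := Finset.sum_le_sum hterm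
    rw [Finset.sum_const, Finset.card_univ, Fintype.card_fin, nsmul_eq_mul] at hsum
    push_cast at hsum
    have hπ : 0 < 2 * π := by positivity
    have key : (b : ℝ) - a ≤ (4 * m + 2 : ℝ) * (π - 2 * Real.arctan (4 * (R - 1) / U)) / (2 * π) := by
      rw [le_div_iff₀ hπ]
      linarith
    linarith

/-- **Tail mass of the `Λ`-distribution.** For `U > 0`, real `R` and ground-state roots on the ring
of `4m + 2` sites, the empirical probability measure of the `Λ_α` gives the complement of `[-R, R]`
mass at most `2/(2m+1) + 2(π - 2 arctan(4(R-1)/U))/π`. [cite: Goldbaum2005, §5, eq. (5.4)] -/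
theorem rapidityMeasure_compl_Icc_le {U : ℝ} (hU : 0 < U) {m : ℕ} {k : Fin (4 * m + 2) → ℝ}
    {Λ : Fin (2 * m + 1) → ℝ} (hk : IsLiebWuGroundRoots U m k Λ) (R : ℝ) :
    (empiricalProbabilityMeasure Λ : Measure ℝ) (Icc (-R) R)ᶜ ≤
      ENNReal.ofReal (2 / (2 * m + 1 : ℝ) + 2 * (π - 2 * Real.arctan (4 * (R - 1) / U)) / π) := by
  classical
  refine (empiricalProbabilityMeasure_apply_le_ofReal Λ _).trans (ENNReal.ofReal_le_ofReal ?_)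
  have hM : (0 : ℝ) < 2 * m + 1 := by positivity
  -- `{α : Λ_α ∉ [-R, R]} ⊆ {Λ_α < -R} ∪ {R < Λ_α}`
  have hsub : (univ.filter fun α => Λ α ∈ (Icc (-R) R)ᶜ) ⊆
      (univ.filter fun α => Λ α < -R) ∪ (univ.filter fun α => R < Λ α) := by
    intro α hα
    simp only [Finset.mem_filter, Finset.mem_univ, true_and, Set.mem_compl_iff, Set.mem_Icc,
      not_and_or, not_le, Finset.mem_union] at hα ⊢
    exact hα
  have hcard : ((univ.filter fun α => Λ α ∈ (Icc (-R) R)ᶜ).card : ℝ) ≤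
      (univ.filter fun α => Λ α < -R).card + (univ.filter fun α => R < Λ α).card := by
    exact_mod_cast (Finset.card_le_card hsub).trans (Finset.card_union_le _ _)
  have h1 := card_filter_rapidity_lt_neg_le hU hk R
  have h2 := card_filter_lt_rapidity_le hU hk R
  have hδ : 0 ≤ π - 2 * Real.arctan (4 * (R - 1) / U) := by
    linarith [Real.arctan_lt_pi_div_two (4 * (R - 1) / U)]
  have hm : ((2 * m : ℕ) : ℝ) + 1 = 2 * m + 1 := by push_cast; ring
  rw [hm, div_le_iff₀ hM]
  have hπ : 0 < π := Real.pi_pos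
  calc ((univ.filter fun α => Λ α ∈ (Icc (-R) R)ᶜ).card : ℝ)
      ≤ 2 + 2 * ((4 * m + 2 : ℝ) * (π - 2 * Real.arctan (4 * (R - 1) / U)) / (2 * π)) := by
        linarith
    _ = (2 / (2 * m + 1 : ℝ) + 2 * (π - 2 * Real.arctan (4 * (R - 1) / U)) / π) * (2 * m + 1) := by
        field_simp
        ring

/-- **Tightness of the `Λ`-distributions (movement 1 for the `Λ`'s; Goldbaum 2005, §5, (5.4)
"`{σ_i}` is uniformly bounded").** For `U > 0` the empirical probability measures of the `Λ_α` of
any family of ground-state roots form a tight set of measures on `ℝ`. [cite: Goldbaum2005, §5, eq. (5.4)] -/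
theorem isTightMeasureSet_rapidityMeasures {U : ℝ} (hU : 0 < U) {k : ∀ m : ℕ, Fin (4 * m + 2) → ℝ}
    {Λ : ∀ m : ℕ, Fin (2 * m + 1) → ℝ} (hk : ∀ m, IsLiebWuGroundRoots U m (k m) (Λ m)) :
    IsTightMeasureSet
      {((μ : ProbabilityMeasure ℝ) : Measure ℝ) |
        μ ∈ Set.range fun m => empiricalProbabilityMeasure (Λ m)} := by
  rw [isTightMeasureSet_iff_exists_isCompact_measure_compl_le]
  intro ε hε
  -- a real `e > 0` with `ofReal e ≤ ε`
  obtain ⟨e, he0, heε⟩ : ∃ e : ℝ, 0 < e ∧ ENNReal.ofReal e ≤ ε := by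
    obtain ⟨r, hr0, hr, hrε⟩ := (ENNReal.lt_iff_exists_real_btwn).1 hε
    exact ⟨r, by simpa using hr, hrε.le⟩
  -- the arctan threshold: `π - 2 arctan(4(R-1)/U) ≤ 2η` for `R ≥ R₀`
  set η : ℝ := min (e * π / 8) (π / 4) with hη
  have hη0 : 0 < η := lt_min (by positivity) (by positivity)
  have hηlt : η < π / 2 := (min_le_right _ _).trans_lt (by linarith [Real.pi_pos])
  set y : ℝ := Real.tan (π / 2 - η) with hy
  have hy0 : 0 < y := Real.tan_pos_of_pos_of_lt_pi_div_two (by linarith) (by linarith)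
  have harctan_y : Real.arctan y = π / 2 - η :=
    Real.arctan_tan (by linarith) (by linarith)
  set R₀ : ℝ := 1 + U * y / 4 with hR₀
  have hR₀0 : 0 ≤ R₀ := by positivity
  have hsmall : ∀ R, R₀ ≤ R → π - 2 * Real.arctan (4 * (R - 1) / U) ≤ 2 * η := by
    intro R hR
    have h1 : y ≤ 4 * (R - 1) / U := by
      rw [le_div_iff₀ hU]
      have : U * y / 4 ≤ R - 1 := by linarith
      nlinarith
    have h2 := Real.arctan_mono h1
    rw [harctan_y] at h2
    linarith
  -- the size threshold: `2/(2m+1) ≤ e/2` for `m ≥ m₀`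
  obtain ⟨m₀, hm₀⟩ := exists_nat_gt (4 / e)
  -- a radius beyond all `Λ`'s of the finitely many small rings
  set R₁ : ℝ := R₀ + ∑ m ∈ Finset.range m₀, ∑ α, |Λ m α| with hR₁
  have hR₀R₁ : R₀ ≤ R₁ := by
    have : 0 ≤ ∑ m ∈ Finset.range m₀, ∑ α, |Λ m α| :=
      Finset.sum_nonneg fun m _ => Finset.sum_nonneg fun α _ => abs_nonneg _
    linarith
  refine ⟨Icc (-R₁) R₁, isCompact_Icc, ?_⟩
  rintro μ ⟨μ', ⟨m, rfl⟩, rfl⟩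
  rcases lt_or_ge m m₀ with hm | hm
  · -- small ring: all its `Λ`'s lie in `[-R₁, R₁]`
    rw [empiricalProbabilityMeasure_apply_eq_zero]
    · exact bot_le
    · intro α hα
      apply hα
      have h1 : |Λ m α| ≤ ∑ α', |Λ m α'| :=
        Finset.single_le_sum (f := fun α' => |Λ m α'|) (fun _ _ => abs_nonneg _) (Finset.mem_univ α)
      have h2 : ∑ α', |Λ m α'| ≤ ∑ m' ∈ Finset.range m₀, ∑ α', |Λ m' α'| :=
        Finset.single_le_sum (f := fun m' => ∑ α', |Λ m' α'|)
          (fun _ _ => Finset.sum_nonneg fun _ _ => abs_nonneg _) (Finset.mem_range.2 hm)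
      have h3 : |Λ m α| ≤ R₁ := by linarith
      exact Set.mem_Icc.2 ⟨by linarith [neg_abs_le (Λ m α)], (le_abs_self _).trans h3⟩
  · -- large ring: the tail estimate
    refine (rapidityMeasure_compl_Icc_le hU (hk m) R₁).trans
      ((ENNReal.ofReal_le_ofReal ?_).trans heε)
    have hm' : (4 / e : ℝ) < m := hm₀.trans_le (by exact_mod_cast hm)
    have hM : (0 : ℝ) < 2 * m + 1 := by positivity
    have h1 : 2 / (2 * m + 1 : ℝ) ≤ e / 2 := by
      rw [div_le_iff₀ hM]
      have : 4 < e * m := by rwa [div_lt_iff₀ he0, mul_comm] at hm'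
      nlinarith
    have h2 : 2 * (π - 2 * Real.arctan (4 * (R₁ - 1) / U)) / π ≤ e / 2 := by
      rw [div_le_iff₀ Real.pi_pos]
      have := hsmall R₁ hR₀R₁
      have hηe : η ≤ e * π / 8 := min_le_left _ _
      nlinarith [Real.pi_pos]
    linarith

/-- **Compactness for the `Λ`'s (Goldbaum 2005, §5, "Banach–Alaoglu").** The closure of the set of
empirical measures of the `Λ_α` of a family of ground-state roots is compact in the topology of
weak convergence (Prokhorov). [cite: Goldbaum2005, §5, eq. (5.4)] -/
theorem isCompact_closure_rapidityMeasures {U : ℝ} (hU : 0 < U)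
    {k : ∀ m : ℕ, Fin (4 * m + 2) → ℝ} {Λ : ∀ m : ℕ, Fin (2 * m + 1) → ℝ}
    (hk : ∀ m, IsLiebWuGroundRoots U m (k m) (Λ m)) :
    IsCompact (closure (Set.range fun m => empiricalProbabilityMeasure (Λ m))) :=
  isCompact_closure_of_isTightMeasureSet (isTightMeasureSet_rapidityMeasures hU hk)

/-! ### Movement 3: from subsequential limits to convergence (F3a′ → F3a → F3, per family and globally) -/

/-- Clamping a continuous test function to `[-π, π]` makes it bounded without changing it on
`[-π, π]`: the bounded continuous function `x ↦ g(max(-π, min(π, x)))`. [folklore] -/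
def clampIcc (g : ℝ → ℝ) (hg : Continuous g) : ℝ →ᵇ ℝ :=
  BoundedContinuousFunction.ofNormedAddCommGroup (fun x => g (max (-π) (min π x)))
    (by fun_prop)
    (Classical.choose (isCompact_Icc.exists_bound_of_continuousOn
      (s := Icc (-π) π) hg.continuousOn))
    (fun x => Classical.choose_spec (isCompact_Icc.exists_bound_of_continuousOn
      (s := Icc (-π) π) hg.continuousOn) _
        (mem_Icc.2 ⟨le_max_left _ _, max_le (neg_le_self Real.pi_pos.le) (min_le_left _ _)⟩))

/-- The clamped function agrees with `g` on `[-π, π]`. [folklore] -/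
theorem clampIcc_apply_of_mem {g : ℝ → ℝ} (hg : Continuous g) {x : ℝ} (hx : x ∈ Icc (-π) π) :
    clampIcc g hg x = g x := by
  change g (max (-π) (min π x)) = g x
  rw [min_eq_right hx.2, max_eq_right hx.1]

/-- Averages of a continuous `g` over ground-state momenta are integrals of the clamped `g` against
the empirical measure: `(Σ_j g(k_j))/(4m+2) = ∫ clampIcc g d((4m+2)⁻¹ Σ δ_{k_j})`.
[cite: Goldbaum2005, Theorem 1.1] -/
theorem sum_div_eq_integral_clampIcc {U : ℝ} {m : ℕ} {k : Fin (4 * m + 2) → ℝ}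
    {Λ : Fin (2 * m + 1) → ℝ} (hk : IsLiebWuGroundRoots U m k Λ) {g : ℝ → ℝ} (hg : Continuous g) :
    (∑ j, g (k j)) / (4 * m + 2 : ℝ) =
      ∫ x, clampIcc g hg x ∂(empiricalProbabilityMeasure k : Measure ℝ) := by
  rw [integral_empiricalProbabilityMeasure]
  have h : ∀ j, clampIcc g hg (k j) = g (k j) := fun j => clampIcc_apply_of_mem hg (hk.2.2.2 j)
  simp only [h]
  push_cast
  ring_nf

/-- **The subsequence principle for the root distributions (Goldbaum 2005, §5, closing paragraph:
"every subsequence of `{ρ_i}`, `{σ_i}` contains a further subsequence that converges to the same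
`ρ` and `σ` [hence] the whole sequence converges"), abstract form.** For one family of ground-state
roots and a bounded continuous test function `g`: if along EVERY subsequence `φ` on which the
empirical distributions of the `k_j` and of the `Λ_α` both converge weakly (to `ν`, `τ`) the limit
satisfies `∫ g dν = c`, then `∫ g d((4m+2)⁻¹ Σ_j δ_{k_j}) → c` along the whole sequence. Proof:
every subsequence has, by the compactness of movement 1 (Prokhorov for the `k`'s and, via the tail
estimate, for the `Λ`'s) and the metrizability of the weak topology (Lévy–Prokhorov), a further
subsequence along which both families converge; `Filter.tendsto_of_subseq_tendsto` concludes.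
[cite: Goldbaum2005, §5, eq. (5.16)] -/
theorem tendsto_integral_rootMeasure_of_subseqLimit {U : ℝ} (hU : 0 < U)
    {k : ∀ m : ℕ, Fin (4 * m + 2) → ℝ} {Λ : ∀ m : ℕ, Fin (2 * m + 1) → ℝ}
    (hk : ∀ m, IsLiebWuGroundRoots U m (k m) (Λ m)) {g : ℝ →ᵇ ℝ} {c : ℝ}
    (h : ∀ (φ : ℕ → ℕ), Tendsto φ atTop atTop → ∀ (ν τ : ProbabilityMeasure ℝ),
      Tendsto (fun n => empiricalProbabilityMeasure (k (φ n))) atTop (𝓝 ν) →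
      Tendsto (fun n => empiricalProbabilityMeasure (Λ (φ n))) atTop (𝓝 τ) →
      ∫ x, g x ∂(ν : Measure ℝ) = c) :
    Tendsto (fun m => ∫ x, g x ∂(empiricalProbabilityMeasure (k m) : Measure ℝ)) atTop (𝓝 c) := by
  refine tendsto_of_subseq_tendsto fun ns hns => ?_
  -- a further subsequence along which the `k`-measures converge ...
  obtain ⟨ν, -, ms₁, hms₁, hν⟩ := (isCompact_closure_rootMeasures hk).tendsto_subseq
    (x := fun n => empiricalProbabilityMeasure (k (ns n)))
    (fun n => subset_closure ⟨ns n, rfl⟩)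
  -- ... and a further one along which the `Λ`-measures converge too
  obtain ⟨τ, -, ms₂, hms₂, hτ⟩ := (isCompact_closure_rapidityMeasures hU hk).tendsto_subseq
    (x := fun n => empiricalProbabilityMeasure (Λ (ns (ms₁ n))))
    (fun n => subset_closure ⟨ns (ms₁ n), rfl⟩)
  refine ⟨ms₁ ∘ ms₂, ?_⟩
  have hφ : Tendsto (fun n => ns (ms₁ (ms₂ n))) atTop atTop :=
    hns.comp (hms₁.tendsto_atTop.comp hms₂.tendsto_atTop)
  have hν' : Tendsto (fun n => empiricalProbabilityMeasure (k (ns (ms₁ (ms₂ n))))) atTop (𝓝 ν) :=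
    hν.comp hms₂.tendsto_atTop
  have key := h (fun n => ns (ms₁ (ms₂ n))) hφ ν τ hν' hτ
  have hint := (ProbabilityMeasure.tendsto_iff_forall_integral_tendsto.1 hν') g
  rw [key] at hint
  exact hint

/-- **F3a for one family from the identification of its subsequential limits (Goldbaum 2005, §5,
(5.16) and closing paragraph).** If along every jointly convergent subsequence of the root
distributions of a family of ground-state roots the `k`-limit `ν` satisfies
`∫ g dν = ∫_{-π}^{π} g ρ₀` for all bounded continuous `g` (movement 2 of the printed proof, the
hypothesis `h`), then for every continuous `g`, `(1/(4m+2)) Σ_j g(k_j) → ∫_{-π}^{π} g ρ₀`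
(continuous `g` are first clamped to `[-π, π]`, which changes neither side).
[cite: Goldbaum2005, §5, eq. (5.16)] -/
theorem tendsto_sum_div_of_subseqLimit {U : ℝ} (hU : 0 < U)
    {k : ∀ m : ℕ, Fin (4 * m + 2) → ℝ} {Λ : ∀ m : ℕ, Fin (2 * m + 1) → ℝ}
    (hk : ∀ m, IsLiebWuGroundRoots U m (k m) (Λ m))
    (h : ∀ (φ : ℕ → ℕ), Tendsto φ atTop atTop → ∀ (ν τ : ProbabilityMeasure ℝ),
      Tendsto (fun n => empiricalProbabilityMeasure (k (φ n))) atTop (𝓝 ν) →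
      Tendsto (fun n => empiricalProbabilityMeasure (Λ (φ n))) atTop (𝓝 τ) →
      ∀ g : ℝ →ᵇ ℝ, ∫ x, g x ∂(ν : Measure ℝ) = ∫ x in (-π)..π, g x * liebWuRho0 U x)
    {g : ℝ → ℝ} (hg : Continuous g) :
    Tendsto (fun m : ℕ => (∑ j, g (k m j)) / (4 * m + 2 : ℝ)) atTop
      (𝓝 (∫ x in (-π)..π, g x * liebWuRho0 U x)) := by
  set gb := clampIcc g hg with hgb
  -- replace `g` by its clamped version on both sides
  have hlim : ∫ x in (-π)..π, g x * liebWuRho0 U x = ∫ x in (-π)..π, gb x * liebWuRho0 U x := by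
    refine intervalIntegral.integral_congr fun x hx => ?_
    rw [Set.uIcc_of_le (by linarith [Real.pi_pos])] at hx
    simp only [hgb, clampIcc_apply_of_mem hg hx]
  have hsum : (fun m : ℕ => (∑ j, g (k m j)) / (4 * m + 2 : ℝ)) =
      fun m => ∫ x, gb x ∂(empiricalProbabilityMeasure (k m) : Measure ℝ) :=
    funext fun m => sum_div_eq_integral_clampIcc (hk m) hg
  rw [hlim, hsum]
  exact tendsto_integral_rootMeasure_of_subseqLimit hU hk
    fun φ hφ ν τ hν hτ => h φ hφ ν τ hν hτ gb

/-- **F3 for one family from the identification of its subsequential limits.** Under the same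
hypothesis `h` (movement 2 of Goldbaum's proof for this family), the Bethe energies per site
`-2 (1/N_a) Σ_j cos k_j` converge to `liebWuEnergy U` (test against `cos` and use the proved F3c,
`liebWuEnergy U = -2 ∫_{-π}^{π} ρ₀ cos`). [cite: Goldbaum2005, §5, eq. (5.16)]
[cite: LiebWuPhysicaA2003, §6, formula for E₀(N_a/2,N_a/2)] -/
theorem betheEnergy_div_tendsto_of_subseqLimit {U : ℝ} (hU : 0 < U)
    {k : ∀ m : ℕ, Fin (4 * m + 2) → ℝ} {Λ : ∀ m : ℕ, Fin (2 * m + 1) → ℝ}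
    (hk : ∀ m, IsLiebWuGroundRoots U m (k m) (Λ m))
    (h : ∀ (φ : ℕ → ℕ), Tendsto φ atTop atTop → ∀ (ν τ : ProbabilityMeasure ℝ),
      Tendsto (fun n => empiricalProbabilityMeasure (k (φ n))) atTop (𝓝 ν) →
      Tendsto (fun n => empiricalProbabilityMeasure (Λ (φ n))) atTop (𝓝 τ) →
      ∀ g : ℝ →ᵇ ℝ, ∫ x, g x ∂(ν : Measure ℝ) = ∫ x in (-π)..π, g x * liebWuRho0 U x) :
    Tendsto (fun m : ℕ => betheEnergy (k m) / (4 * m + 2 : ℝ)) atTop (𝓝 (liebWuEnergy U)) := by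
  have hlim := (tendsto_sum_div_of_subseqLimit hU hk h Real.continuous_cos).const_mul (-2)
  rw [← liebWuEnergy_eq_integral_cos_mul_liebWuRho0 hU] at hlim
  refine hlim.congr fun m => ?_
  rw [betheEnergy]
  ring

/-- **Movement 2 for all families → F3a (Goldbaum 2005, §5).** If for every `U > 0` and every
family of ground-state roots the subsequential `k`-limits are `ρ₀ dk` (the identification step of
the printed proof, hypothesis `h`), then F3a `goldbaum_rootDensity_tendsto` holds.
[cite: Goldbaum2005, §5, eq. (5.16)] -/
theorem goldbaum_rootDensity_tendsto_of_subseqLimit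
    (h : ∀ (U : ℝ), 0 < U → ∀ (k : ∀ m : ℕ, Fin (4 * m + 2) → ℝ) (Λ : ∀ m : ℕ, Fin (2 * m + 1) → ℝ),
      (∀ m, IsLiebWuGroundRoots U m (k m) (Λ m)) → ∀ (φ : ℕ → ℕ), Tendsto φ atTop atTop →
      ∀ (ν τ : ProbabilityMeasure ℝ),
        Tendsto (fun n => empiricalProbabilityMeasure (k (φ n))) atTop (𝓝 ν) →
        Tendsto (fun n => empiricalProbabilityMeasure (Λ (φ n))) atTop (𝓝 τ) →
        ∀ g : ℝ →ᵇ ℝ, ∫ x, g x ∂(ν : Measure ℝ) = ∫ x in (-π)..π, g x * liebWuRho0 U x) :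
    goldbaum_rootDensity_tendsto := fun U hU k Λ hk _g hg =>
  tendsto_sum_div_of_subseqLimit hU hk (h U hU k Λ hk) hg

/-- **Movement 2 for all families → F3.** Under the same hypothesis, F3 `liebWu_betheEnergy_tendsto`
holds (via F3a and the proved F3a → F3, `liebWu_betheEnergy_tendsto_of_rootDensity`). After this
file, discharging F3 = proving the identification step (movement 2) of Goldbaum's §5.
[cite: Goldbaum2005, §5, eq. (5.16)] [cite: LiebWuPhysicaA2003, §6] -/
theorem liebWu_betheEnergy_tendsto_of_subseqLimit
    (h : ∀ (U : ℝ), 0 < U → ∀ (k : ∀ m : ℕ, Fin (4 * m + 2) → ℝ) (Λ : ∀ m : ℕ, Fin (2 * m + 1) → ℝ),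
      (∀ m, IsLiebWuGroundRoots U m (k m) (Λ m)) → ∀ (φ : ℕ → ℕ), Tendsto φ atTop atTop →
      ∀ (ν τ : ProbabilityMeasure ℝ),
        Tendsto (fun n => empiricalProbabilityMeasure (k (φ n))) atTop (𝓝 ν) →
        Tendsto (fun n => empiricalProbabilityMeasure (Λ (φ n))) atTop (𝓝 τ) →
        ∀ g : ℝ →ᵇ ℝ, ∫ x, g x ∂(ν : Measure ℝ) = ∫ x in (-π)..π, g x * liebWuRho0 U x) :
    liebWu_betheEnergy_tendsto :=
  liebWu_betheEnergy_tendsto_of_rootDensity (goldbaum_rootDensity_tendsto_of_subseqLimit h)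

end Literature.MathematicalPhysics.QuantumLattice
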